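import Summits.ValiantsHypothesis.ValiantsHypothesis.Theorems.GrenetZeonDualUnipotentThreeHalvesLongMassLedgerTorusSlowCurve

/-!
# PART VI (H_coord in the power currency: `slow_iff_coordinate_span`, `not_slow_of_count`) — Theorems-side port of val-idea-28 g5's staged `…LongMassLedgerTorus.lean` (sha16 98392e2975984a00, 1360 l., 84 decls;
# itself the verbatim Part I/II-basics/III/IV/V/VI/VII extract of the crux workfile `Cruxes/DualUnipotentThreeHalves/InitialForm.lean` rev 14;
# crit-7 g3 V40 δ-READ ✓ of rev 13, STAGE REQUEST; desk val-lit RULINGS #389/#391/#392 «LedgerTorus claim protocol»; hand val-port-3 g3 «CLAIM LedgerTorus» 00:52Z)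

PORT NOTE.  Decl texts VERBATIM BY NAME; namespaces as staged (`…Theorems.GrenetZeon.InitialForm.*`); the ONLY changes are one-line docstrings on helper lemmas the gate's `lint.docstring` requires (marked «docstring added in the port»), the 400-line-cap SPLIT into five
chained modules `GrenetZeonDualUnipotentThreeHalvesLongMassLedgerTorus{Initial, Curve, SlowCurve, Slow, ∅}.lean` (this file imports `GrenetZeonDualUnipotentThreeHalvesLongMassLedgerTorusSlowCurve`) and these headers; `--supports stmt-ValiantsHypothesis-24318`
helper.  ALL CREDIT: val-idea-28 g5 (lens «degeneration – orbit-closure»).  HONEST STATUS (author's, verbatim in spirit): an INSTRUMENT — the normal form of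
(c)-certificates under a torus symmetry; proves NO case of (c) `SlowCore.LongMassSlowLawInv`, is NOT progress on (c); crux 24318 OPEN; VP ≠ VNP is NOT proved.
The author's full module docstring is reproduced in `GrenetZeonDualUnipotentThreeHalvesLongMassLedgerTorusInitial.lean`.
-/

set_option linter.dupNamespace false

noncomputable section

/-! # PART VI — H_coord IN THE POWER CURRENCY: `Slow` certificates of torus-equivariant pencils may be taken weight-graded (rev 8)

The currency of record is now `Slow` (`Theorems…SlowCoreDefs`, R2ᵖ `HeavyTopSlowLaw`).  The torus-closure argument of Part II is
currency-free: the `Slow` cone `{v | ∀ x a b, deg_s (N(x+sv)^{n-1})_{ab} ≤ k}` is cut out by the polynomial family of Part V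
(`G 0 (fun _ => N) x e a b` at `t = 0`, LEMMA U) and is TORUS-STABLE for a torus-equivariant pencil, because the torus acts on the
coordinate ring by `θ : X_e ↦ τ^{w e} X_e`, `lineSubst x v ∘ θ = lineSubst (λx) (λv)`, and equivariance on points lifts to the
POLYNOMIAL identity `N.map θ = (a•D) N D'` (`MvPolynomial.funext`); conjugation by constant matrices and a nonzero scalar do not raise
`s`-degrees of powers.  Hence `slow_graded_of_torusEquivariant` (graded certificate, same `k`, same dimension) and the monomial
count `not_slow_of_count : … → ¬ SlowCore.Slow n m N` BY NAME (Part IV's `exists_wild_coordinate`). -/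

namespace Summit.ValiantsHypothesis.ValiantsHypothesis.Theorems.GrenetZeon.InitialForm.SlowTorus

open Summit.ValiantsHypothesis.ValiantsHypothesis.Cruxes.TwoDimCoefficients.DimTwoCases (AffMat IsAffine)
open Summit.ValiantsHypothesis.ValiantsHypothesis.Theorems.GrenetZeon.RadicalSplit (lineSubst)
open Summit.ValiantsHypothesis.ValiantsHypothesis.Theorems.GrenetZeon.InitialForm.TorusClosure (TorusEquivariant
  torusAct_inv_cancel map_eval_map_C)
open Summit.ValiantsHypothesis.ValiantsHypothesis.Theorems.GrenetZeon.InitialForm.SlowCurve (curve G eval_G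
  totalDegree_le_iff_coeff)

variable {n m : ℕ}

/-- The torus automorphism of the coordinate ring: `X_e ↦ τ^{w e} · X_e`. -/
def θ (w : Fin n × Fin n → ℕ) (τ : ℂ) : MvPolynomial (Fin n × Fin n) ℂ →+* MvPolynomial (Fin n × Fin n) ℂ :=
  MvPolynomial.eval₂Hom MvPolynomial.C fun e => MvPolynomial.C (τ ^ w e) * MvPolynomial.X e

/-- `eval_comp_θ` — helper of this port (see the module docstring for its role). (docstring added in the port) -/
theorem eval_comp_θ (w : Fin n × Fin n → ℕ) (τ : ℂ) (y : Fin n × Fin n → ℂ) :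
    (MvPolynomial.eval y).comp (θ w τ) = MvPolynomial.eval (torusAct w τ y) := by
  apply MvPolynomial.ringHom_ext
  · intro c; simp [θ]
  · intro e; simp [θ, torusAct]

/-- `lineSubst_comp_θ` — helper of this port (see the module docstring for its role). (docstring added in the port) -/
theorem lineSubst_comp_θ (w : Fin n × Fin n → ℕ) (τ : ℂ) (x v : Fin n × Fin n → ℂ) :
    (lineSubst x v : MvPolynomial (Fin n × Fin n) ℂ →+* MvPolynomial (Fin 1) ℂ).comp (θ w τ)
      = (lineSubst (torusAct w τ x) (torusAct w τ v) : MvPolynomial (Fin n × Fin n) ℂ →+* MvPolynomial (Fin 1) ℂ) := by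
  apply MvPolynomial.ringHom_ext
  · intro c; simp [θ, lineSubst]
  · intro e
    simp only [θ, lineSubst, torusAct, RingHom.coe_comp, RingHom.coe_coe, Function.comp_apply, MvPolynomial.eval₂Hom_X',
      map_mul, MvPolynomial.algHom_C, MvPolynomial.aeval_X, mul_add, Finset.mul_sum, mul_assoc, MvPolynomial.algebraMap_eq]

/-- Point equivariance lifts to the POLYNOMIAL identity `N.map θ = (a • D) · N · D'` (constants embedded by `C`). -/
theorem map_θ_eq (N : AffMat n m) {w : Fin n × Fin n → ℕ} {τ : ℂ} {a : ℂ} {D D' : Matrix (Fin m) (Fin m) ℂ}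
    (hconj : ∀ x, N.map (MvPolynomial.eval (torusAct w τ x)) = a • (D * N.map (MvPolynomial.eval x) * D')) :
    N.map (θ w τ) = (a • D).map MvPolynomial.C * N * D'.map MvPolynomial.C := by
  have key : ∀ y : Fin n × Fin n → ℂ, (N.map (θ w τ)).map (MvPolynomial.eval y)
      = ((a • D).map MvPolynomial.C * N * D'.map MvPolynomial.C).map (MvPolynomial.eval y) := by
    intro y
    have hc : (⇑(MvPolynomial.eval y) ∘ ⇑(θ w τ) : MvPolynomial (Fin n × Fin n) ℂ → ℂ)
        = ⇑(MvPolynomial.eval (torusAct w τ y)) := by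
      have := congrArg DFunLike.coe (eval_comp_θ w τ y)
      simpa using this
    rw [Matrix.map_map, hc, hconj y, Matrix.map_mul, Matrix.map_mul, map_eval_map_C, map_eval_map_C, Matrix.smul_mul,
      Matrix.smul_mul]
  refine Matrix.ext fun i j => MvPolynomial.funext fun y => ?_
  have := congrFun (congrFun (key y) i) j
  simpa only [Matrix.map_apply] using this

/-- `C`-embedded constants pass through `lineSubst`. -/
theorem map_C_map_lineSubst (X : Matrix (Fin m) (Fin m) ℂ) (x v : Fin n × Fin n → ℂ) :
    (X.map (MvPolynomial.C : ℂ → MvPolynomial (Fin n × Fin n) ℂ)).map (lineSubst x v)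
      = X.map (MvPolynomial.C : ℂ → MvPolynomial (Fin 1) ℂ) := by
  ext i j : 1
  · simp [Matrix.map_apply, MvPolynomial.algHom_C]

/-- ★ The line polynomial at a torus-moved direction is a constant conjugate (times a nonzero scalar) of the line polynomial at the
original direction over the torus-moved base point. -/
theorem map_lineSubst_torusAct (N : AffMat n m) {w : Fin n × Fin n → ℕ} {τ : ℂ} {a : ℂ} {D D' : Matrix (Fin m) (Fin m) ℂ}
    (hconj : ∀ x, N.map (MvPolynomial.eval (torusAct w τ x)) = a • (D * N.map (MvPolynomial.eval x) * D'))
    (x v : Fin n × Fin n → ℂ) :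
    N.map (lineSubst (torusAct w τ x) (torusAct w τ v))
      = a • (D.map MvPolynomial.C * N.map (lineSubst x v) * D'.map MvPolynomial.C) := by
  have hc : (⇑(lineSubst x v) ∘ ⇑(θ w τ) : MvPolynomial (Fin n × Fin n) ℂ → MvPolynomial (Fin 1) ℂ)
      = ⇑(lineSubst (torusAct w τ x) (torusAct w τ v)) := by
    have := congrArg DFunLike.coe (lineSubst_comp_θ w τ x v)
    simpa using this
  have h1 : N.map (lineSubst (torusAct w τ x) (torusAct w τ v)) = (N.map (θ w τ)).map (lineSubst x v) := by
    rw [Matrix.map_map, hc]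
  have h2 : ((a • D).map MvPolynomial.C * N * D'.map MvPolynomial.C).map (lineSubst x v)
      = (a • D).map (MvPolynomial.C : ℂ → MvPolynomial (Fin 1) ℂ) * N.map (lineSubst x v)
          * D'.map (MvPolynomial.C : ℂ → MvPolynomial (Fin 1) ℂ) := by
    have e1 := map_mul (lineSubst x v).toRingHom.mapMatrix ((a • D).map MvPolynomial.C * N) (D'.map MvPolynomial.C)
    have e2 := map_mul (lineSubst x v).toRingHom.mapMatrix ((a • D).map MvPolynomial.C) N
    rw [e2] at e1
    simp only [RingHom.mapMatrix_apply] at e1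
    have e1' : ((a • D).map MvPolynomial.C * N * D'.map MvPolynomial.C).map (lineSubst x v)
        = ((a • D).map MvPolynomial.C).map (lineSubst x v) * N.map (lineSubst x v)
            * (D'.map MvPolynomial.C).map (lineSubst x v) := e1
    rw [e1', map_C_map_lineSubst, map_C_map_lineSubst]
  have h3 : (a • D).map (MvPolynomial.C : ℂ → MvPolynomial (Fin 1) ℂ) = a • D.map (MvPolynomial.C : ℂ → MvPolynomial (Fin 1) ℂ) := by
    ext i j : 1
    · simp [Matrix.map_apply, MvPolynomial.smul_eq_C_mul]
  rw [h1, map_θ_eq N hconj, h2, h3, Matrix.smul_mul, Matrix.smul_mul]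

/-- Powers of a constant conjugate. -/
theorem conj_pow {R : Type*} [CommRing R] (E E' Q : Matrix (Fin m) (Fin m) R) (hE'E : E' * E = 1) (b : ℕ) :
    (E * Q * E') ^ b = E * Q ^ b * E' ∨ b = 0 := by
  induction b with
  | zero => exact Or.inr rfl
  | succ b ih =>
    left
    rcases ih with ih | ih
    · rw [pow_succ, ih, pow_succ]
      simp only [Matrix.mul_assoc]
      rw [← Matrix.mul_assoc E' E, hE'E, Matrix.one_mul]
    · subst ih; simp

/-- Constant conjugation and scalars do not raise `s`-degrees. -/
theorem totalDegree_conj_le (D D' : Matrix (Fin m) (Fin m) ℂ) (a : ℂ) (M : Matrix (Fin m) (Fin m) (MvPolynomial (Fin 1) ℂ))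
    {k : ℕ} (hM : ∀ c d, (M c d).totalDegree ≤ k) (i j : Fin m) :
    ((a • (D.map MvPolynomial.C * M * D'.map MvPolynomial.C) : Matrix (Fin m) (Fin m) (MvPolynomial (Fin 1) ℂ)) i j).totalDegree
      ≤ k := by
  rw [Matrix.smul_apply]
  refine (MvPolynomial.totalDegree_smul_le _ _).trans ?_
  rw [Matrix.mul_apply]
  refine (MvPolynomial.totalDegree_finsetSum _ _).trans (Finset.sup_le fun d _ => ?_)
  refine (MvPolynomial.totalDegree_mul _ _).trans ?_
  rw [Matrix.map_apply, MvPolynomial.totalDegree_C, add_zero, Matrix.mul_apply]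
  refine (MvPolynomial.totalDegree_finsetSum _ _).trans (Finset.sup_le fun c _ => ?_)
  refine (MvPolynomial.totalDegree_mul _ _).trans ?_
  rw [Matrix.map_apply, MvPolynomial.totalDegree_C, zero_add]
  exact hM c d

/-- ★ **The `Slow` cone of a torus-equivariant pencil is torus-stable.** -/
theorem slowCone_torusAct (N : AffMat n m) {w : Fin n × Fin n → ℕ} (hT : TorusEquivariant N w) {k : ℕ}
    {v : Fin n × Fin n → ℂ} (hv : ∀ x : Fin n × Fin n → ℂ, ∀ a b : Fin m, ((((N.map (lineSubst x v)) ^ (n - 1)) a b)).totalDegree ≤ k)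
    {τ : ℂ} (hτ : τ ≠ 0) (x : Fin n × Fin n → ℂ) (a b : Fin m) :
    ((((N.map (lineSubst x (torusAct w τ v))) ^ (n - 1)) a b)).totalDegree ≤ k := by
  obtain ⟨c, D, D', hc, -, hD'D, hconj⟩ := hT τ hτ
  set x' := torusAct w τ⁻¹ x with hx'
  have hx : x = torusAct w τ x' := (torusAct_inv_cancel w hτ x).symm
  rw [hx, map_lineSubst_torusAct N hconj x' v, smul_pow]
  have hE'E : D'.map (MvPolynomial.C : ℂ → MvPolynomial (Fin 1) ℂ) * D.map MvPolynomial.C = 1 := by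
    rw [← Matrix.map_mul, hD'D, Matrix.map_one MvPolynomial.C (map_zero _) (map_one _)]
  rcases conj_pow (D.map MvPolynomial.C) (D'.map MvPolynomial.C) (N.map (lineSubst x' v)) hE'E (n - 1) with h | h
  · rw [h]
    exact totalDegree_conj_le D D' (c ^ (n - 1)) _ (fun i j => hv x' i j) a b
  · rw [h, pow_zero, pow_zero, one_smul, Matrix.one_apply]
    split_ifs <;> simp

/-- `curve 0 (fun _ => N) 0 = N`. -/
theorem curve_const_zero (N : AffMat n m) : curve 0 (fun _ => N) 0 = N := by
  simp [curve]

/-- The `Slow` cone is cut out by the polynomial family `{(G 0 (fun _ => N) x e a b)|_{t=0} : k < e}`. -/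
def slowFamily (N : AffMat n m) (k : ℕ) : Set (MvPolynomial (Fin n × Fin n) ℂ) :=
  {H | ∃ (x : Fin n × Fin n → ℂ) (e : ℕ) (a b : Fin m), k < e ∧
    H = MvPolynomial.map (Polynomial.evalRingHom 0) (G 0 (fun _ => N) x e a b)}

/-- `slowCone_iff_family` — helper of this port (see the module docstring for its role). (docstring added in the port) -/
theorem slowCone_iff_family (N : AffMat n m) (k : ℕ) (v : Fin n × Fin n → ℂ) :
    (∀ x : Fin n × Fin n → ℂ, ∀ a b : Fin m, ((((N.map (lineSubst x v)) ^ (n - 1)) a b)).totalDegree ≤ k)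
      ↔ ∀ H ∈ slowFamily N k, MvPolynomial.eval v H = 0 := by
  constructor
  · rintro h H ⟨x, e, a, b, he, rfl⟩
    rw [eval_G, curve_const_zero]
    exact (totalDegree_le_iff_coeff _ k).mp (h x a b) e he
  · intro h x a b
    rw [totalDegree_le_iff_coeff]
    intro e he
    have := h _ ⟨x, e, a, b, he, rfl⟩
    rwa [eval_G, curve_const_zero] at this

/-- ★ **H_coord IN THE POWER CURRENCY.**  A `Slow` certificate `(K, k)` of a torus-equivariant affine pencil can be replaced by a
WEIGHT-GRADED one of the same dimension and the same `k`. -/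
theorem slow_graded_of_torusEquivariant (N : AffMat n m) (w : Fin n × Fin n → ℕ) (hT : TorusEquivariant N w)
    (K : Submodule ℂ (Fin n × Fin n → ℂ)) (k : ℕ)
    (hK : ∀ x v : Fin n × Fin n → ℂ, v ∈ K → ∀ a b : Fin m, ((((N.map (lineSubst x v)) ^ (n - 1)) a b)).totalDegree ≤ k) :
    ∃ K₀ : Submodule ℂ (Fin n × Fin n → ℂ), Module.finrank ℂ K₀ = Module.finrank ℂ K ∧
      (∀ s ∈ K₀, ∀ c, wtProj w c s ∈ K₀) ∧
      ∀ x v : Fin n × Fin n → ℂ, v ∈ K₀ → ∀ a b : Fin m, ((((N.map (lineSubst x v)) ^ (n - 1)) a b)).totalDegree ≤ k := by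
  have hstab : ∀ τ : ℂ, τ ≠ 0 → ∀ v ∈ K, ∀ H ∈ slowFamily N k, MvPolynomial.eval (torusAct w τ v) H = 0 := by
    intro τ hτ v hv
    rw [← slowCone_iff_family]
    exact fun x a b => slowCone_torusAct N hT (fun x a b => hK x v hv a b) hτ x a b
  obtain ⟨K₀, hdim, hgr, hZ⟩ := exists_graded_of_torusStable w K (slowFamily N k) hstab
  exact ⟨K₀, hdim, hgr, fun x v hv a b => ((slowCone_iff_family N k v).mpr (hZ v hv)) x a b⟩

/-- ★ **MONOMIAL COUNT, POWER CURRENCY — `¬ Slow` BY NAME.**  For a torus-equivariant affine pencil whose coordinates off `Z` have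
singleton weight classes: if for every budget `k` (`k + 2 ≤ n`) the number of coordinates `e ∉ Z` whose coordinate direction `δ_e` is
`k`-slow along every line, plus `#Z`, is at most `(k+1)·n`, then `N` is NOT `Slow` (`Theorems…SlowCore.Slow`, the body of S3/R2ᵖ). -/
theorem not_slow_of_count (N : AffMat n m) (w : Fin n × Fin n → ℕ) (hT : TorusEquivariant N w)
    (Z : Finset (Fin n × Fin n)) (hZ : ∀ e, e ∉ Z → ∀ e', w e' = w e → e' = e)
    (hcount : ∀ k : ℕ, k + 2 ≤ n →
      (open Classical in (Finset.univ.filter fun e => e ∉ Z ∧ ∀ x : Fin n × Fin n → ℂ, ∀ a b : Fin m,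
        ((((N.map (lineSubst x (Pi.single e (1 : ℂ)))) ^ (n - 1)) a b)).totalDegree ≤ k).card) + Z.card ≤ (k + 1) * n) :
    ¬ Summit.ValiantsHypothesis.ValiantsHypothesis.Theorems.GrenetZeon.SlowCore.Slow n m N := by
  classical
  rintro ⟨K, k, hK, hdim⟩
  have hkn : k + 2 ≤ n := by
    have h1 : Module.finrank ℂ K ≤ n * n := by
      have := Submodule.finrank_le K
      simpa [Module.finrank_fintype_fun_eq_card, Fintype.card_prod, Fintype.card_fin] using this
    have h2 : (k + 1) * n < n * n := lt_of_lt_of_le hdim h1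
    have := Nat.lt_of_mul_lt_mul_right h2
    omega
  obtain ⟨K₀, hdim₀, hgr, hK₀⟩ := slow_graded_of_torusEquivariant N w hT K k hK
  obtain ⟨e, -, hTame, hmem⟩ := exists_wild_coordinate w Z hZ
    (fun e => ∀ x : Fin n × Fin n → ℂ, ∀ a b : Fin m,
      ((((N.map (lineSubst x (Pi.single e (1 : ℂ)))) ^ (n - 1)) a b)).totalDegree ≤ k)
    K₀ hgr (by have := hcount k hkn; omega)
  exact hTame fun x a b => hK₀ x _ hmem a b

/-- Part V's conclusion BY NAME: along a polynomial curve, an algebraic `k`-slow family of generic dimension `> (k+1)·n` makes the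
member `t = 0` `Slow` in the sense of `Theorems…SlowCore.Slow`. -/
theorem slow_curve_zero_byName (d : ℕ) (F : ℕ → AffMat n m) (k : ℕ)
    (N : Submodule (Polynomial ℂ) (Fin n × Fin n → Polynomial ℂ)) (S : Finset ℂ)
    (hcert : ∀ t : ℂ, t ∉ S → ∀ p ∈ N, ∀ x : Fin n × Fin n → ℂ, ∀ a b : Fin m,
      ((((curve d F t).map (lineSubst x (CurveClosure.ev t p))) ^ (n - 1)) a b).totalDegree ≤ k)
    (hdim : (k + 1) * n < Module.finrank (Polynomial ℂ) N) :
    Summit.ValiantsHypothesis.ValiantsHypothesis.Theorems.GrenetZeon.SlowCore.Slow n m (curve d F 0) :=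
  SlowCurve.slow_curve_zero_of_algebraic_family d F k N S hcert hdim

/-- Coordinate vectors indexed by a finset are linearly independent, so their span has dimension `#T`. -/
theorem finrank_span_single (T : Finset (Fin n × Fin n)) :
    Module.finrank ℂ (Submodule.span ℂ (Set.range fun e : T => (Pi.single (e : Fin n × Fin n) (1 : ℂ) : Fin n × Fin n → ℂ)))
      = T.card := by
  have hli : LinearIndependent ℂ (fun e : T => (Pi.single (e : Fin n × Fin n) (1 : ℂ) : Fin n × Fin n → ℂ)) := by
    have := (Pi.basisFun ℂ (Fin n × Fin n)).linearIndependent.comp (fun e : T => (e : Fin n × Fin n)) Subtype.coe_injective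
    convert this using 1
    funext e; simp
  rw [finrank_span_eq_card hli, Fintype.card_coe]

/-- ★ **EXACT CHARACTERISATION (by name).**  For a torus-equivariant affine pencil all of whose coordinates have DISTINCT weights,
`Slow` holds iff some coordinate SET `T` with `#T > (k+1)·n` spans a subspace inside the `k`-slow cone.  (Only ⟹ is non-trivial: the
graded certificate of `slow_graded_of_torusEquivariant` is the span of the coordinate vectors it contains.  The per-coordinate census
`not_slow_of_count` is the contrapositive of the weaker consequence `#{e | δ_e is k-slow} ≥ #T`; tameness of each `δ_e` separately does NOT
give `Slow` — the cone is not a subspace.) -/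
theorem slow_iff_coordinate_span (N : AffMat n m) (w : Fin n × Fin n → ℕ) (hT : TorusEquivariant N w) (hw : Function.Injective w) :
    Summit.ValiantsHypothesis.ValiantsHypothesis.Theorems.GrenetZeon.SlowCore.Slow n m N ↔
      ∃ (k : ℕ) (T : Finset (Fin n × Fin n)), (k + 1) * n < T.card ∧
        ∀ x v : Fin n × Fin n → ℂ,
          v ∈ Submodule.span ℂ (Set.range fun e : T => (Pi.single (e : Fin n × Fin n) (1 : ℂ) : Fin n × Fin n → ℂ)) →
          ∀ a b : Fin m, ((((N.map (lineSubst x v)) ^ (n - 1)) a b)).totalDegree ≤ k := by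
  classical
  constructor
  · rintro ⟨K, k, hK, hdim⟩
    obtain ⟨K₀, hdim₀, hgr, hK₀⟩ := slow_graded_of_torusEquivariant N w hT K k hK
    set T : Finset (Fin n × Fin n) := Finset.univ.filter fun e => (Pi.single e (1 : ℂ) : Fin n × Fin n → ℂ) ∈ K₀ with hTdef
    set Sp := Submodule.span ℂ (Set.range fun e : T => (Pi.single (e : Fin n × Fin n) (1 : ℂ) : Fin n × Fin n → ℂ)) with hSp
    have hZ : ∀ e, e ∉ (∅ : Finset (Fin n × Fin n)) → ∀ e', w e' = w e → e' = e := fun e _ e' h => hw h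
    -- the graded certificate is spanned by the coordinate vectors it contains
    have hle : K₀ ≤ Sp := by
      intro s hs
      have hsum : s = ∑ e, s e • (Pi.single e (1 : ℂ) : Fin n × Fin n → ℂ) := by
        conv_lhs => rw [← Finset.univ_sum_single s]
        refine Finset.sum_congr rfl fun e _ => ?_
        funext e'
        by_cases h : e' = e
        · subst h; simp
        · simp [h]
      rw [hsum]
      refine Submodule.sum_mem _ fun e _ => ?_
      by_cases hse : s e = 0
      · rw [hse, zero_smul]; exact Submodule.zero_mem _
      · have hmem : (Pi.single e (1 : ℂ) : Fin n × Fin n → ℂ) ∈ K₀ := by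
          have h1 := hgr s hs (w e)
          rw [wtProj_eq_single w ∅ hZ (Finset.notMem_empty e) s] at h1
          have h2 := K₀.smul_mem (s e)⁻¹ h1
          rwa [smul_smul, inv_mul_cancel₀ hse, one_smul] at h2
        have heT : e ∈ T := by rw [hTdef, Finset.mem_filter]; exact ⟨Finset.mem_univ _, hmem⟩
        exact Submodule.smul_mem _ _ (Submodule.subset_span ⟨⟨e, heT⟩, rfl⟩)
    have hge : Sp ≤ K₀ := by
      rw [hSp, Submodule.span_le]
      rintro _ ⟨⟨e, he⟩, rfl⟩
      rw [hTdef, Finset.mem_filter] at he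
      exact he.2
    refine ⟨k, T, ?_, fun x v hv a b => hK₀ x v (hge hv) a b⟩
    have h1 : Module.finrank ℂ K₀ ≤ Module.finrank ℂ Sp := Submodule.finrank_mono hle
    rw [hSp, finrank_span_single] at h1
    omega
  · rintro ⟨k, T, hcard, hcone⟩
    exact ⟨_, k, fun x v hv a b => hcone x v hv a b, by rw [finrank_span_single]; exact hcard⟩

end Summit.ValiantsHypothesis.ValiantsHypothesis.Theorems.GrenetZeon.InitialForm.SlowTorus
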